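import Summits.ABC.IUTFork.Cor312StepNodesRecloseA

/-!
# [IUTchIII] Cor. 3.12, proof steps — the kernel DAG step nodes SOLVED FOR CONTENT and RE-CLOSED, part B:
# steps (v)–(ix) (FACT-LIST rows F-2159 (v), F-2160 (vi), F-2161 (vii), F-2162 (viii), F-2158 (ix); zero FACT binders)

S. Mochizuki, *Inter-universal Teichmüller theory III*, proof of Cor. 3.12, kurims `.tex` p. 177 l. 9 – p. 180 l. 42
[Mochizuki2012; claim key, status disputed]: the method steps — relating the units via the unit portion of the link
and bi-coricity (v), log-Kummer via Galois evaluation / conjugate synchronization / the three cyclotomic rigidities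
(vi), separation and multiradiality of the symmetries (vii), resolution of the conjugacy indeterminacies (viii), the
`F_mod`-translation at the cost of (Ind3) (ix). PROOF-ONLY companion (no definition, no instance, no named fact;
abc-iut cell, seat abc-iut-L1-d1 gen 11) of the index nodes `Summit.ABC.IUTFork.DAG.N_IUTchIII_Cor3_12_pf_<s>`
(`DAGC312b.lean`), continuing part A (generic lemmas `stepNode_*`, whose module docstring has the full account) with
the same name-matched one-liners per node: `_iff` (SOLVED FOR CONTENT: cited loci granted ⟹ invoked observations ⟹
drawn observations, spelled out), `_not_automatic` + `not_forall_…` (THE UNIVERSAL CLOSURE OVER BOTH READINGS IS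
REFUTED — explicit reading granting everything but one conclusion; the schema is not a theorem, its instance forms
are the content), `forall_obs_…_iff` / `forall_loci_…_iff` (the two partial closures DECIDED), and the ZERO-BINDER
instances at the typed observation readings: Scholze–Stix identified-copies `Cor312.Setting.identifiedObs`
([ScholzeStix2018] §2.2 — these five nodes draw no contentful observation), TEAM A's `Cor312Proof.honestReading`, the
pre-(x) overlay `Cor312Vol.PreX.OPreX`; the reading of record `DAG.obsReadingA` is part p's `…_holds` (not restated).

HONEST FRAMING. A step node is an INFERENCE of a disputed text under explicit readings; "re-closed" = OUR kernel
theorems about that inference with no assumption-class binder. Nothing here bears on the disputed node (xi-f), takes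
a side on [IUTchIII] Cor. 3.12 or on any author, or asserts that abc is proved or refuted; typed ≠ proved; indexed ≠
endorsed. [claim: Mochizuki2012, status: disputed]
-/

namespace Summit.ABC.IUTFork.DAG

open Cor312Proof Thm311 Literature.IUT.LogThetaLattice

variable (pending : Locus → Prop) (O : Obs → Prop) {T : ThetaIndex} {S : Situation T} (P : Cor312.Setting S)
  (C : Column S.L) (D : ThetaLinkStrips P.LogLink P.Strip) (L : Locus → Prop) (A : InputStrip.StripAlgorithm P)
  (base : Obs → Prop)

/-! ### (v) `N_IUTchIII_Cor3_12_pf_v` — row F-2159 · p. 177 l. 9–34 -/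

/-- (v) SOLVED FOR CONTENT: its eight cited loci granted ⟹ (observation (i) `linkSplits` ⟹ `unitsRelatedContainers`
and `frobeniusLikeRelatedToCoric`). [claim: Mochizuki2012, status: disputed] -/
theorem N_IUTchIII_Cor3_12_pf_v_iff :
    N_IUTchIII_Cor3_12_pf_v pending O ↔
      ((∀ c ∈ Step.v.cites, pending c) → O .linkSplits → O .unitsRelatedContainers ∧
        O .frobeniusLikeRelatedToCoric) :=
  (stepNode_iff pending O .v).trans (by simp [Step.uses, Step.concl, Step.data])
/-- NOT AUTOMATIC: all loci and all observations but `unitsRelatedContainers` granted violates the node. [folklore]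
-/
theorem N_IUTchIII_Cor3_12_pf_v_not_automatic :
    ¬ N_IUTchIII_Cor3_12_pf_v (fun _ => True) (fun o => o ≠ .unitsRelatedContainers) :=
  stepNode_not_automatic_of_mem .v _ (by decide) (by decide)
/-- ∀-CLOSURE REFUTED (schema; instance forms are the content). [folklore] -/
theorem not_forall_N_IUTchIII_Cor3_12_pf_v :
    ¬ ∀ (pending' : Locus → Prop) (O' : Obs → Prop), N_IUTchIII_Cor3_12_pf_v pending' O' :=
  stepNode_not_forall .v
/-- Closure over observation readings: iff not all eight cited loci are granted. [folklore] -/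
theorem forall_obs_N_IUTchIII_Cor3_12_pf_v_iff :
    (∀ O' : Obs → Prop, N_IUTchIII_Cor3_12_pf_v pending O') ↔ ¬ ∀ c ∈ Step.v.cites, pending c :=
  stepNode_forall_obs_iff pending .v
/-- Closure over loci readings: iff the node's content implication holds for `O`. [folklore] -/
theorem forall_loci_N_IUTchIII_Cor3_12_pf_v_iff :
    (∀ pending' : Locus → Prop, N_IUTchIII_Cor3_12_pf_v pending' O) ↔
      (O .linkSplits → O .unitsRelatedContainers ∧ O .frobeniusLikeRelatedToCoric) :=
  (stepNode_forall_loci_iff O .v).trans (by simp [Step.uses, Step.concl, Step.data])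
/-- Zero binders at the Scholze–Stix identified-copies reading (no contentful conclusion). [folklore] -/
theorem N_IUTchIII_Cor3_12_pf_v_holds_identifiedObs : N_IUTchIII_Cor3_12_pf_v pending P.identifiedObs :=
  stepNode_holds_identifiedObs pending P .v (by decide)
/-- Zero binders at TEAM A's honest reading. [folklore] -/
theorem N_IUTchIII_Cor3_12_pf_v_holds_honestReading :
    N_IUTchIII_Cor3_12_pf_v pending (honestReading P C D L A) :=
  stepNode_holds_honestReading_preX pending P .v (by decide) C D L A
/-- Zero binders at the pre-(x) overlay. [folklore] -/
theorem N_IUTchIII_Cor3_12_pf_v_holds_OPreX : N_IUTchIII_Cor3_12_pf_v pending (Cor312Vol.PreX.OPreX P base) :=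
  stepNode_holds_OPreX_preX pending P .v (by decide) base

/-! ### (vi) `N_IUTchIII_Cor3_12_pf_vi` — row F-2160 · p. 177 l. 35 – p. 179 l. 18 -/

/-- (vi) SOLVED FOR CONTENT: its twenty-three cited loci granted ⟹ (observation (v) `frobeniusLikeRelatedToCoric` ⟹
the three provenance observations of (vi)). [claim: Mochizuki2012, status: disputed] -/
theorem N_IUTchIII_Cor3_12_pf_vi_iff :
    N_IUTchIII_Cor3_12_pf_vi pending O ↔
      ((∀ c ∈ Step.vi.cites, pending c) → O .frobeniusLikeRelatedToCoric → O .logKummerViaGaloisEvaluation ∧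
        O .conjSyncLogLinkCompatible ∧ O .cycRigidityApproaches) :=
  (stepNode_iff pending O .vi).trans (by simp [Step.uses, Step.concl, Step.data])
/-- NOT AUTOMATIC: all loci and all observations but `logKummerViaGaloisEvaluation` granted violates the node.
[folklore] -/
theorem N_IUTchIII_Cor3_12_pf_vi_not_automatic :
    ¬ N_IUTchIII_Cor3_12_pf_vi (fun _ => True) (fun o => o ≠ .logKummerViaGaloisEvaluation) :=
  stepNode_not_automatic_of_mem .vi _ (by decide) (by decide)
/-- ∀-CLOSURE REFUTED (schema; instance forms are the content). [folklore] -/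
theorem not_forall_N_IUTchIII_Cor3_12_pf_vi :
    ¬ ∀ (pending' : Locus → Prop) (O' : Obs → Prop), N_IUTchIII_Cor3_12_pf_vi pending' O' :=
  stepNode_not_forall .vi
/-- Closure over observation readings: iff not all twenty-three cited loci are granted. [folklore] -/
theorem forall_obs_N_IUTchIII_Cor3_12_pf_vi_iff :
    (∀ O' : Obs → Prop, N_IUTchIII_Cor3_12_pf_vi pending O') ↔ ¬ ∀ c ∈ Step.vi.cites, pending c :=
  stepNode_forall_obs_iff pending .vi
/-- Closure over loci readings: iff the node's content implication holds for `O`. [folklore] -/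
theorem forall_loci_N_IUTchIII_Cor3_12_pf_vi_iff :
    (∀ pending' : Locus → Prop, N_IUTchIII_Cor3_12_pf_vi pending' O) ↔
      (O .frobeniusLikeRelatedToCoric → O .logKummerViaGaloisEvaluation ∧ O .conjSyncLogLinkCompatible ∧
        O .cycRigidityApproaches) :=
  (stepNode_forall_loci_iff O .vi).trans (by simp [Step.uses, Step.concl, Step.data])
/-- Zero binders at the Scholze–Stix identified-copies reading (no contentful conclusion). [folklore] -/
theorem N_IUTchIII_Cor3_12_pf_vi_holds_identifiedObs : N_IUTchIII_Cor3_12_pf_vi pending P.identifiedObs :=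
  stepNode_holds_identifiedObs pending P .vi (by decide)
/-- Zero binders at TEAM A's honest reading. [folklore] -/
theorem N_IUTchIII_Cor3_12_pf_vi_holds_honestReading :
    N_IUTchIII_Cor3_12_pf_vi pending (honestReading P C D L A) :=
  stepNode_holds_honestReading_preX pending P .vi (by decide) C D L A
/-- Zero binders at the pre-(x) overlay. [folklore] -/
theorem N_IUTchIII_Cor3_12_pf_vi_holds_OPreX : N_IUTchIII_Cor3_12_pf_vi pending (Cor312Vol.PreX.OPreX P base) :=
  stepNode_holds_OPreX_preX pending P .vi (by decide) base

/-! ### (vii) `N_IUTchIII_Cor3_12_pf_vii` — row F-2161 · p. 179 l. 19 – p. 180 l. 10 -/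

/-- (vii) SOLVED FOR CONTENT: its eight cited loci granted ⟹ (observation (vi) `cycRigidityApproaches` ⟹
`symmetriesSeparate` and `symmetriesMultiradial`). [claim: Mochizuki2012, status: disputed] -/
theorem N_IUTchIII_Cor3_12_pf_vii_iff :
    N_IUTchIII_Cor3_12_pf_vii pending O ↔
      ((∀ c ∈ Step.vii.cites, pending c) → O .cycRigidityApproaches → O .symmetriesSeparate ∧
        O .symmetriesMultiradial) :=
  (stepNode_iff pending O .vii).trans (by simp [Step.uses, Step.concl, Step.data])
/-- NOT AUTOMATIC: all loci and all observations but `symmetriesSeparate` granted violates the node. [folklore] -/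
theorem N_IUTchIII_Cor3_12_pf_vii_not_automatic :
    ¬ N_IUTchIII_Cor3_12_pf_vii (fun _ => True) (fun o => o ≠ .symmetriesSeparate) :=
  stepNode_not_automatic_of_mem .vii _ (by decide) (by decide)
/-- ∀-CLOSURE REFUTED (schema; instance forms are the content). [folklore] -/
theorem not_forall_N_IUTchIII_Cor3_12_pf_vii :
    ¬ ∀ (pending' : Locus → Prop) (O' : Obs → Prop), N_IUTchIII_Cor3_12_pf_vii pending' O' :=
  stepNode_not_forall .vii
/-- Closure over observation readings: iff not all eight cited loci are granted. [folklore] -/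
theorem forall_obs_N_IUTchIII_Cor3_12_pf_vii_iff :
    (∀ O' : Obs → Prop, N_IUTchIII_Cor3_12_pf_vii pending O') ↔ ¬ ∀ c ∈ Step.vii.cites, pending c :=
  stepNode_forall_obs_iff pending .vii
/-- Closure over loci readings: iff the node's content implication holds for `O`. [folklore] -/
theorem forall_loci_N_IUTchIII_Cor3_12_pf_vii_iff :
    (∀ pending' : Locus → Prop, N_IUTchIII_Cor3_12_pf_vii pending' O) ↔
      (O .cycRigidityApproaches → O .symmetriesSeparate ∧ O .symmetriesMultiradial) :=
  (stepNode_forall_loci_iff O .vii).trans (by simp [Step.uses, Step.concl, Step.data])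
/-- Zero binders at the Scholze–Stix identified-copies reading (no contentful conclusion). [folklore] -/
theorem N_IUTchIII_Cor3_12_pf_vii_holds_identifiedObs : N_IUTchIII_Cor3_12_pf_vii pending P.identifiedObs :=
  stepNode_holds_identifiedObs pending P .vii (by decide)
/-- Zero binders at TEAM A's honest reading. [folklore] -/
theorem N_IUTchIII_Cor3_12_pf_vii_holds_honestReading :
    N_IUTchIII_Cor3_12_pf_vii pending (honestReading P C D L A) :=
  stepNode_holds_honestReading_preX pending P .vii (by decide) C D L A
/-- Zero binders at the pre-(x) overlay. [folklore] -/
theorem N_IUTchIII_Cor3_12_pf_vii_holds_OPreX : N_IUTchIII_Cor3_12_pf_vii pending (Cor312Vol.PreX.OPreX P base) :=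
  stepNode_holds_OPreX_preX pending P .vii (by decide) base

/-! ### (viii) `N_IUTchIII_Cor3_12_pf_viii` — row F-2162 · p. 180 l. 11–20 -/

/-- (viii) SOLVED FOR CONTENT: its five cited loci granted ⟹ (observation (vii) `symmetriesSeparate` ⟹
`conjugacyIndetResolved`). [claim: Mochizuki2012, status: disputed] -/
theorem N_IUTchIII_Cor3_12_pf_viii_iff :
    N_IUTchIII_Cor3_12_pf_viii pending O ↔
      ((∀ c ∈ Step.viii.cites, pending c) → O .symmetriesSeparate → O .conjugacyIndetResolved) :=
  (stepNode_iff pending O .viii).trans (by simp [Step.uses, Step.concl, Step.data])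
/-- NOT AUTOMATIC: all loci and all observations but `conjugacyIndetResolved` granted violates the node. [folklore]
-/
theorem N_IUTchIII_Cor3_12_pf_viii_not_automatic :
    ¬ N_IUTchIII_Cor3_12_pf_viii (fun _ => True) (fun o => o ≠ .conjugacyIndetResolved) :=
  stepNode_not_automatic_of_mem .viii _ (by decide) (by decide)
/-- ∀-CLOSURE REFUTED (schema; instance forms are the content). [folklore] -/
theorem not_forall_N_IUTchIII_Cor3_12_pf_viii :
    ¬ ∀ (pending' : Locus → Prop) (O' : Obs → Prop), N_IUTchIII_Cor3_12_pf_viii pending' O' :=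
  stepNode_not_forall .viii
/-- Closure over observation readings: iff not all five cited loci are granted. [folklore] -/
theorem forall_obs_N_IUTchIII_Cor3_12_pf_viii_iff :
    (∀ O' : Obs → Prop, N_IUTchIII_Cor3_12_pf_viii pending O') ↔ ¬ ∀ c ∈ Step.viii.cites, pending c :=
  stepNode_forall_obs_iff pending .viii
/-- Closure over loci readings: iff the node's content implication holds for `O`. [folklore] -/
theorem forall_loci_N_IUTchIII_Cor3_12_pf_viii_iff :
    (∀ pending' : Locus → Prop, N_IUTchIII_Cor3_12_pf_viii pending' O) ↔
      (O .symmetriesSeparate → O .conjugacyIndetResolved) :=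
  (stepNode_forall_loci_iff O .viii).trans (by simp [Step.uses, Step.concl, Step.data])
/-- Zero binders at the Scholze–Stix identified-copies reading (no contentful conclusion). [folklore] -/
theorem N_IUTchIII_Cor3_12_pf_viii_holds_identifiedObs : N_IUTchIII_Cor3_12_pf_viii pending P.identifiedObs :=
  stepNode_holds_identifiedObs pending P .viii (by decide)
/-- Zero binders at TEAM A's honest reading. [folklore] -/
theorem N_IUTchIII_Cor3_12_pf_viii_holds_honestReading :
    N_IUTchIII_Cor3_12_pf_viii pending (honestReading P C D L A) :=
  stepNode_holds_honestReading_preX pending P .viii (by decide) C D L A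
/-- Zero binders at the pre-(x) overlay. [folklore] -/
theorem N_IUTchIII_Cor3_12_pf_viii_holds_OPreX : N_IUTchIII_Cor3_12_pf_viii pending (Cor312Vol.PreX.OPreX P base) :=
  stepNode_holds_OPreX_preX pending P .viii (by decide) base

/-! ### (ix) `N_IUTchIII_Cor3_12_pf_ix` — row F-2158 · p. 180 l. 21–42 -/

/-- (ix) SOLVED FOR CONTENT: Rmk 3.10.1 and (Ind3) granted ⟹ (observations (vii) `symmetriesSeparate` and (v)
`unitsRelatedContainers` ⟹ `fmodTranslation`). [claim: Mochizuki2012, status: disputed] -/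
theorem N_IUTchIII_Cor3_12_pf_ix_iff :
    N_IUTchIII_Cor3_12_pf_ix pending O ↔
      ((∀ c ∈ Step.ix.cites, pending c) → O .symmetriesSeparate → O .unitsRelatedContainers → O .fmodTranslation) :=
  (stepNode_iff pending O .ix).trans (by simp [Step.uses, Step.concl, Step.data])
/-- NOT AUTOMATIC: all loci and all observations but `fmodTranslation` granted violates the node. [folklore] -/
theorem N_IUTchIII_Cor3_12_pf_ix_not_automatic :
    ¬ N_IUTchIII_Cor3_12_pf_ix (fun _ => True) (fun o => o ≠ .fmodTranslation) :=
  stepNode_not_automatic_of_mem .ix _ (by decide) (by decide)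
/-- ∀-CLOSURE REFUTED (schema; instance forms are the content). [folklore] -/
theorem not_forall_N_IUTchIII_Cor3_12_pf_ix :
    ¬ ∀ (pending' : Locus → Prop) (O' : Obs → Prop), N_IUTchIII_Cor3_12_pf_ix pending' O' :=
  stepNode_not_forall .ix
/-- Closure over observation readings: iff not all two cited loci are granted. [folklore] -/
theorem forall_obs_N_IUTchIII_Cor3_12_pf_ix_iff :
    (∀ O' : Obs → Prop, N_IUTchIII_Cor3_12_pf_ix pending O') ↔ ¬ ∀ c ∈ Step.ix.cites, pending c :=
  stepNode_forall_obs_iff pending .ix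
/-- Closure over loci readings: iff the node's content implication holds for `O`. [folklore] -/
theorem forall_loci_N_IUTchIII_Cor3_12_pf_ix_iff :
    (∀ pending' : Locus → Prop, N_IUTchIII_Cor3_12_pf_ix pending' O) ↔
      (O .symmetriesSeparate → O .unitsRelatedContainers → O .fmodTranslation) :=
  (stepNode_forall_loci_iff O .ix).trans (by simp [Step.uses, Step.concl, Step.data])
/-- Zero binders at the Scholze–Stix identified-copies reading (no contentful conclusion). [folklore] -/
theorem N_IUTchIII_Cor3_12_pf_ix_holds_identifiedObs : N_IUTchIII_Cor3_12_pf_ix pending P.identifiedObs :=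
  stepNode_holds_identifiedObs pending P .ix (by decide)
/-- Zero binders at TEAM A's honest reading. [folklore] -/
theorem N_IUTchIII_Cor3_12_pf_ix_holds_honestReading :
    N_IUTchIII_Cor3_12_pf_ix pending (honestReading P C D L A) :=
  stepNode_holds_honestReading_preX pending P .ix (by decide) C D L A
/-- Zero binders at the pre-(x) overlay. [folklore] -/
theorem N_IUTchIII_Cor3_12_pf_ix_holds_OPreX : N_IUTchIII_Cor3_12_pf_ix pending (Cor312Vol.PreX.OPreX P base) :=
  stepNode_holds_OPreX_preX pending P .ix (by decide) base

end Summit.ABC.IUTFork.DAG
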